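import Summits.Ventures.WeilGRH.ReflectionTransfer
import Summits.Ventures.WeilGRH.TwoPrimeReflectionInequality
import HarnessLib

/-!
# GRH arm (rh-explicit, venture WeilGRH): the reflection transfer on the two-prime window

On a window `[-a, a]` with `log 3 ≤ 2a ≤ 2 log 2` the prime powers `n = 2, 3` enter the explicit
formula of `k = g ⋆ g̃` and, for a character `χ` mod `q ≠ 1`,

`Re Q_χ(g) ≥ Re Q_ζ(g) − 2|c|² + (log q)‖g‖₂² + 2k₂' Re[(1 − χ(2)) k(log 2)] + 2k₃' Re[(1 − χ(3)) k(log 3)]`,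

`k₂' = log 2/√2`, `k₃' = log 3/√3`, `c = ∫ g cosh(x/2)` (`ReflectionTransfer.lean` bookkeeping plus the
two-term prime difference `weilPrimeTerm_sub_weilPrimeTermChar_two`). The prime `2` is treated by the
reflection, the prime `3` crudely out of a budget `δ ≥ k₃'‖1 − χ(3)‖` on the folded window
(`reflection_inequality_two_prime`). **Two-prime reflection transfer**: with `κ = k₂'‖1 − χ(2)‖`,
`κ + δ < B ≤ log q`, Weil positivity for `ζ` on `[-a, a]` and the cleared criterion

`2·[C_M ((B−δ)² − κ²) + 2B ((B−δ)·C_A − k₂'·Re(1 − χ(2))·I_A)] ≤ B ((B−δ)² − κ²)`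

one gets `WeilPositivityOnChar χ a`. The `ζ` rungs available here are `59/100`
(`weilPositivityOn_59_100`) and `log 2` (`EvenWinsBeyondArch.weilPositivityOn_log_two`); the numerical
instances are in `TwoPrimeReflectionRungs.lean`.

## References

* A. Weil (1952), (11) and the «lemme» p. 262; H. Yoshida (1992) §6.
-/

noncomputable section

open Complex Filter Set MeasureTheory
open scoped Real Topology ComplexConjugate ArithmeticFunction.vonMangoldt

namespace Summit.Ventures.WeilGRH

open Literature.NumberTheory.LFunctions

variable {q : ℕ} {g : ℝ → ℂ}

/-! ## The two-term prime difference on `[-2 log 2, 2 log 2]` -/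

/-- On `[-2 log 2, 2 log 2]` only `n = 2, 3` can contribute to a prime sum: for `n ∉ {2, 3}` either
`Λ(n) = 0` (`n = 0, 1`) or `k(± log n) = 0` (`n ≥ 4`: `log n ≥ log 4 = 2 log 2` is off the open
support). [folklore] -/
theorem vonMangoldt_eq_zero_or_apply_log_eq_zero_two {k : ℝ → ℂ} (hk : Continuous k)
    (h : tsupport k ⊆ Icc (-(2 * Real.log 2)) (2 * Real.log 2)) {n : ℕ}
    (hn : n ∉ ({2, 3} : Finset ℕ)) :
    ((Λ n : ℝ) : ℂ) = 0 ∨ (k (Real.log n) = 0 ∧ k (-Real.log n) = 0) := by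
  have hsupp := support_subset_Ioo_of_tsupport_subset_Icc hk h
  simp only [Finset.mem_insert, Finset.mem_singleton, not_or] at hn
  rcases Nat.lt_or_ge n 4 with h4 | h4
  · left
    interval_cases n
    · simp
    · simp
    · exact absurd rfl hn.1
    · exact absurd rfl hn.2
  · right
    have hlog : 2 * Real.log 2 ≤ Real.log n := by
      rw [← Real.log_rpow (by norm_num), show ((2 : ℝ) ^ (2 : ℝ)) = 4 by norm_num]
      exact Real.log_le_log (by norm_num) (by exact_mod_cast h4)
    constructor
    · by_contra hne
      have := (hsupp hne).2
      linarith
    · by_contra hne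
      have := (hsupp hne).1
      linarith

/-- The difference of the `ζ` and `χ` prime terms on `[-2 log 2, 2 log 2]` is the sum of the `n = 2`
and `n = 3` terms `(Λ(n)/√n)·[(1 − χ(n)) k(log n) + (1 − conj χ(n)) k(−log n)]`.
[cite: Weil1952FormulesExplicites, (11) pp. 261–262, prime term] -/
theorem weilPrimeTerm_sub_weilPrimeTermChar_two (χ : DirichletCharacter ℂ q) {k : ℝ → ℂ}
    (hk : Continuous k) (h : tsupport k ⊆ Icc (-(2 * Real.log 2)) (2 * Real.log 2)) :
    weilPrimeTerm k - weilPrimeTermChar χ k =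
      ∑ n ∈ ({2, 3} : Finset ℕ), ((Λ n : ℝ) : ℂ) / (Real.sqrt n : ℂ) *
        ((1 - χ (n : ZMod q)) * k (Real.log n) + (1 - conj (χ (n : ZMod q))) * k (-Real.log n)) := by
  have hz := fun n (hn : n ∉ ({2, 3} : Finset ℕ)) ↦
    vonMangoldt_eq_zero_or_apply_log_eq_zero_two hk h hn
  have h1 : weilPrimeTerm k = ∑ n ∈ ({2, 3} : Finset ℕ),
      ((Λ n : ℝ) : ℂ) / (Real.sqrt n : ℂ) * (k (Real.log n) + k (-Real.log n)) := by
    unfold weilPrimeTerm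
    refine tsum_eq_sum fun n hn ↦ ?_
    rcases hz n hn with h0 | ⟨ha, hb⟩
    · simp [h0]
    · simp [ha, hb]
  have h2 : weilPrimeTermChar χ k = ∑ n ∈ ({2, 3} : Finset ℕ),
      ((Λ n : ℝ) : ℂ) / (Real.sqrt n : ℂ) *
        (χ (n : ZMod q) * k (Real.log n) + conj (χ (n : ZMod q)) * k (-Real.log n)) := by
    unfold weilPrimeTermChar
    refine tsum_eq_sum fun n hn ↦ ?_
    rcases hz n hn with h0 | ⟨ha, hb⟩
    · simp [h0]
    · simp [ha, hb]
  rw [h1, h2, ← Finset.sum_sub_distrib]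
  refine Finset.sum_congr rfl fun n _ ↦ ?_
  ring

/-- **The two one-prime corrections through the reflection identity**: on `[-2 log 2, 2 log 2]`,
`Re[P_ζ(k) − P_χ(k)] = 2(log 2/√2)·Re[(1 − χ(2)) k(log 2)] + 2(log 3/√3)·Re[(1 − χ(3)) k(log 3)]`.
[cite: Weil1952FormulesExplicites, (11) pp. 261–262, prime term] -/
theorem re_weilPrimeTerm_sub_weilPrimeTermChar_two (χ : DirichletCharacter ℂ q) (hg : IsWeilTest g)
    (h : tsupport (weilConv g (weilReflect g)) ⊆ Icc (-(2 * Real.log 2)) (2 * Real.log 2)) :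
    (weilPrimeTerm (weilConv g (weilReflect g)) - weilPrimeTermChar χ (weilConv g (weilReflect g))).re =
      2 * (Real.log 2 / Real.sqrt 2) *
          ((1 - χ (2 : ZMod q)) * weilConv g (weilReflect g) (Real.log 2)).re +
        2 * (Real.log 3 / Real.sqrt 3) *
          ((1 - χ (3 : ZMod q)) * weilConv g (weilReflect g) (Real.log 3)).re := by
  set k := weilConv g (weilReflect g) with hk
  have hkc : Continuous k := (hg.weilConv hg.weilReflect).1.continuous
  rw [weilPrimeTerm_sub_weilPrimeTermChar_two χ hkc h, Finset.sum_pair (by norm_num), add_re]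
  have hterm : ∀ (p : ℕ), p.Prime → (((Λ p : ℝ) : ℂ) / (Real.sqrt p : ℂ) *
      ((1 - χ (p : ZMod q)) * k (Real.log p) + (1 - conj (χ (p : ZMod q))) * k (-Real.log p))).re =
      2 * (Real.log p / Real.sqrt p) * ((1 - χ (p : ZMod q)) * k (Real.log p)).re := by
    intro p hp
    have hneg : k (-Real.log p) = conj (k (Real.log p)) := by
      rw [hk, ← conj_weilConv_weilReflect_neg g (Real.log p), Complex.conj_conj]
    have hΛ : ((Λ p : ℝ) : ℂ) / (Real.sqrt p : ℂ) = ((Real.log p / Real.sqrt p : ℝ) : ℂ) := by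
      rw [ArithmeticFunction.vonMangoldt_apply_prime hp]
      push_cast
      ring
    set z : ℂ := (1 - χ (p : ZMod q)) * k (Real.log p) with hz
    have hsum : (1 - χ (p : ZMod q)) * k (Real.log p) +
        (1 - conj (χ (p : ZMod q))) * k (-Real.log p) = ((2 * z.re : ℝ) : ℂ) := by
      have : (1 - conj (χ (p : ZMod q))) * k (-Real.log p) = conj z := by
        rw [hz, hneg, map_mul, map_sub, map_one]
      rw [this, Complex.add_conj, Complex.ofReal_mul, Complex.ofReal_ofNat]
    rw [hsum, hΛ, ← Complex.ofReal_mul, Complex.ofReal_re]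
    ring
  have h2 := hterm 2 Nat.prime_two
  have h3 := hterm 3 Nat.prime_three
  simp only [Nat.cast_ofNat] at h2 h3 ⊢
  rw [h2, h3]

/-! ## The two-prime reflection transfer -/

/-- **TWO-PRIME REFLECTION TRANSFER (any parity, any `χ(2)`, `χ(3)`).** Let `log 3 ≤ 2a`,
`a ≤ log 2`, `q ≠ 1`, `χ` mod `q`, `u = 1 − χ(2)`, `κ = (log 2/√2)‖u‖`, `δ ≥ (log 3/√3)‖1 − χ(3)‖`,
`κ + δ < B ≤ log q`, `m, C_M, C_A, I_A` the closed forms of the one-prime window. If Weil positivity for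
`ζ` holds on `[-a, a]` and `2·[C_M ((B−δ)² − κ²) + 2B ((B−δ) C_A − (log 2/√2) Re(u) I_A)] ≤ B((B−δ)² − κ²)`
then `WeilPositivityOnChar χ a`. [cite: Weil1952FormulesExplicites, (11) and the «lemme» p. 262; Yoshida1992 §6] -/
theorem weilPositivityOnChar_transfer_reflection_two_prime [NeZero q] {a : ℝ}
    (ha3 : Real.log 3 ≤ 2 * a) (ha4 : a ≤ Real.log 2) (hζ : WeilPositivityOn a) (hq1 : q ≠ 1)
    (χ : DirichletCharacter ℂ q) {B κ δ : ℝ} (hBq : B ≤ Real.log q)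
    (hκ : κ = Real.log 2 / Real.sqrt 2 * ‖1 - χ (2 : ZMod q)‖)
    (hδ : Real.log 3 / Real.sqrt 3 * ‖1 - χ (3 : ZMod q)‖ ≤ δ) (hκB : κ + δ < B)
    {m CM CA IA : ℝ} (hm : m = Real.log 2 - a) (hCM : CM = Real.sinh m + m)
    (hCA : CA = (Real.sinh a - Real.sinh m + (a - m)) / 2)
    (hIA : IA = (a - m) * Real.cosh (Real.log 2 / 2) / 2 + Real.sinh (a - Real.log 2 / 2))
    (hcrit : 2 * (CM * ((B - δ) ^ 2 - κ ^ 2) +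
        2 * B * ((B - δ) * CA - Real.log 2 / Real.sqrt 2 * (1 - χ (2 : ZMod q)).re * IA)) ≤
      B * ((B - δ) ^ 2 - κ ^ 2)) :
    WeilPositivityOnChar χ a := by
  intro g hg hsupp
  set L := Real.log 2 with hL
  set L₃ := Real.log 3 with hL₃
  set k' : ℝ := Real.log 2 / Real.sqrt 2 with hk'
  set k₃ : ℝ := Real.log 3 / Real.sqrt 3 with hk₃
  set u : ℂ := 1 - χ (2 : ZMod q) with hu
  set u₃ : ℂ := 1 - χ (3 : ZMod q) with hu₃
  set r : ℝ := ‖u‖ with hr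
  have hk'0 : 0 < k' := div_pos (Real.log_pos (by norm_num)) (by positivity)
  have hk₃0 : 0 < k₃ := div_pos (Real.log_pos (by norm_num)) (by positivity)
  have hr0 : 0 ≤ r := norm_nonneg _
  have hκ0 : 0 ≤ κ := by rw [hκ]; exact mul_nonneg hk'0.le hr0
  have hδ0 : 0 ≤ δ := le_trans (mul_nonneg hk₃0.le (norm_nonneg _)) hδ
  have hB : 0 < B := by linarith
  -- the phase `ω` of `u`
  obtain ⟨ω, hω, huω⟩ : ∃ ω : ℂ, ‖ω‖ = 1 ∧ u = (r : ℂ) * ω := by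
    by_cases hu0 : u = 0
    · exact ⟨1, by simp, by simp [hr, hu0]⟩
    · have hr' : r ≠ 0 := by rw [hr]; exact norm_ne_zero_iff.2 hu0
      refine ⟨u / (r : ℂ), ?_, ?_⟩
      · rw [norm_div, Complex.norm_real, Real.norm_eq_abs, abs_of_nonneg hr0, hr, div_self]
        exact norm_ne_zero_iff.2 hu0
      · rw [mul_div_cancel₀ _ (by exact_mod_cast hr')]
  have hωre : (r : ℝ) * ω.re = u.re := by
    rw [huω, Complex.re_ofReal_mul]
  set kL := weilConv g (weilReflect g) L with hkL
  set kL₃ := weilConv g (weilReflect g) L₃ with hkL₃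
  set N : ℝ := ∫ x, ‖g x‖ ^ 2 with hN
  set c : ℂ := ∫ x, g x * (Real.cosh (x / 2) : ℂ) with hc
  obtain ⟨S, hS, hW0, hineq⟩ :=
    reflection_inequality_two_prime hg hsupp ha3 ha4 hω hκ0 hδ0 hκB hm hCM hCA hIA
  set B' : ℝ := B - δ with hB'
  set W : ℝ := B * N - δ * S + 2 * κ * (ω * kL).re with hW
  set G : ℝ := CM / B + (CA + ω.re * IA) / (B - δ + κ) + (CA - ω.re * IA) / (B - δ - κ) with hG
  have hBp : 0 < B - δ + κ := by linarith
  have hBm : 0 < B - δ - κ := by linarith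
  -- `2G ≤ 1` from the cleared criterion
  have hκre : κ * ω.re = k' * u.re := by
    rw [hκ, ← hωre, hk', hr]; ring
  have hGB : G * (B * ((B - δ + κ) * (B - δ - κ))) =
      CM * ((B - δ) ^ 2 - κ ^ 2) + 2 * B * ((B - δ) * CA - k' * u.re * IA) := by
    rw [hG, ← hκre]
    field_simp
    ring
  have h2G : 2 * G ≤ 1 := by
    have hpos : 0 < B * ((B - δ + κ) * (B - δ - κ)) := by positivity
    refine le_of_mul_le_mul_right ?_ hpos
    calc 2 * G * (B * ((B - δ + κ) * (B - δ - κ)))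
        = 2 * (G * (B * ((B - δ + κ) * (B - δ - κ)))) := by ring
      _ = 2 * (CM * ((B - δ) ^ 2 - κ ^ 2) + 2 * B * ((B - δ) * CA - k' * u.re * IA)) := by rw [hGB]
      _ ≤ B * ((B - δ) ^ 2 - κ ^ 2) := hcrit
      _ = 1 * (B * ((B - δ + κ) * (B - δ - κ))) := by ring
  have hc2 : 2 * ‖c‖ ^ 2 ≤ W := by
    have : ‖c‖ ^ 2 ≤ W * G := hineq
    nlinarith
  -- the corrections
  have hk : tsupport (weilConv g (weilReflect g)) ⊆ Icc (-(2 * Real.log 2)) (2 * Real.log 2) :=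
    (tsupport_weilConv_weilReflect_subset hg.2 hsupp).trans (Icc_subset_Icc (by linarith) (by linarith))
  have hD := re_weilPrimeTerm_sub_weilPrimeTermChar_two χ hg hk
  have hDW : 2 * κ * (ω * kL).re = 2 * k' * (u * kL).re := by
    rw [huω, mul_assoc (r : ℂ), Complex.re_ofReal_mul, hκ, hk', hr]
    ring
  -- the prime `3`: `2k₃ Re(u₃ k(L₃)) ≥ −δ S`
  have hS0 : 0 ≤ S := le_trans (by positivity) hS
  have h3 : -(δ * S) ≤ 2 * k₃ * (u₃ * kL₃).re := by
    have h1 : |(u₃ * kL₃).re| ≤ ‖u₃‖ * ‖kL₃‖ := by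
      rw [← norm_mul]; exact Complex.abs_re_le_norm _
    have h2 : k₃ * ‖u₃‖ * (2 * ‖kL₃‖) ≤ δ * S :=
      mul_le_mul hδ hS (by positivity) hδ0
    have h4 := (abs_le.1 h1).1
    have h5 := mul_le_mul_of_nonneg_left h4 (by positivity : (0 : ℝ) ≤ 2 * k₃)
    linarith only [h2, h5]
  have hmain := re_weilQuadraticChar_ge hq1 χ hg
  have hζg : 0 ≤ (weilQuadratic g).re := hζ g hg hsupp
  have hP := two_mul_re_weilMellin_le hg
  have hN0 : 0 ≤ N := integral_nonneg fun t ↦ by positivity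
  have hNB : B * N ≤ N * Real.log q := by
    have h := mul_le_mul_of_nonneg_left hBq hN0
    rwa [mul_comm N B] at h
  rw [hD] at hmain
  rw [hW, hDW] at hc2
  linarith

end Summit.Ventures.WeilGRH
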